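import Mathlib
import HarnessLib
import Summits.Ventures.LatticeQCDFlow.Exactness.SU2ExpDriftWork

/-!
# `SU(2)` rung — THE ENERGY ERROR OF THE ENGINE'S `n`-STEP LEAPFROG PROPOSAL WITH THE CONSISTENT HALF KICK IS SECOND ORDER, WITH EXPLICIT CONSTANTS: `|ΔH| ≤ n·K·(‖p‖ + (2n+1)D_max/(4κ))·|ε|·(8(Σ_l‖p_l‖ + (2n+1)|ι|D_max/(4κ)) + |ι|D_max/κ)` for ANY action whose coordinate gradient along the Pauli drift is bounded by `D_max` and `K`-Lipschitz in the matrix sup norm — the «acceptance vs step size» law of the row on the `SU(2)` rung, typed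

HONEST FRAMING: exact (Metropolis-corrected) sampling algorithms for lattice gauge theory;
figures of merit are autocorrelation/cost numbers at stated couplings and volumes; no
continuum-physics claim.

Venture `LatticeQCDFlow` (cell pub-lqcd), topic `Exactness`; FANOUT row 14 (`eng-flowhmc`, engine
`latflow.fthmc`, family B; the row's test columns «acceptance vs step size», `⟨e^{−ΔH}⟩ = 1`).  The `SU(2)`
twin of `U1LeapfrogEnergyError`.  NEW WORK of the cell over the tree: `SU2ExpDriftWork` (§1 the drift moves a
configuration by `≤ 8|ε|‖p‖` in the matrix sup norm; §2 the work identity and the first-order Taylor bound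
`4|ε|K‖p‖Σ‖p_l‖` for any action), row 9's kernel of record `SU2MultiStepLeapfrogHMC` / `SUNMultiStepLeapfrogHMC`
(`su2ExpDrift`, `su2Kinetic κ p = κΣ_l‖p_l‖²`, `su2Kinetic_neg`, the `n`-step proposal
`sunLeapfrogProposalN pauliCoordι pauliCoordι_skew ε g n = flip ∘ (palindromicWord [kick g] (drift (mulDrift (su2ExpDrift ε))))ⁿ`
via `sunExpDrift_pauliCoordι` — the proposal inside `su2LeapfrogHMCN ε κ hg S n`), `SplittingIntegrator` /
`SplittingWords` (`kick`, `drift`, `mulDrift`, `flip`, `palindromicWord`); nothing is cited as a fact; no number.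
The action `S : (ι → SU(2)) → ℝ` is ARBITRARY (the FT action `β S_W∘F − log J` of any member); only three
properties of its coordinate gradient `D = D^ε S`, `D(W)_l = (∂_{a_l^i} S(e_ε(a)·W)|_{a=0})_i ∈ ℝ³`, enter:
differentiability of `a ↦ S(e_ε(a)·W)` at `0`, `‖D(W)_l‖ ≤ D_max`, and `‖D(W) − D(W')‖ ≤ K‖coeConfig W − coeConfig W'‖`
(the norm in which `SU2WilsonFlowLOExactForceRegular` / `SU2ExactForceRegularUniform` and
`SU2ResidualExactForceRegular(Uniform)` type the exact force `Φ_κ = κ·D¹S̃` of the LO and the learned member,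
with volume-free constants; `D^ε S̃ = (ε/κ)Φ_κ`, so `D_max`, `K` are `O(ε)`).  The half kick is the CONSISTENT
one, `g = −D/(4κ)` — the one for which kick–drift–kick is the leapfrog discretisation of `H = S + κΣ‖p_l‖²` in the
time unit of the drift (`U(1)` twin: `U1LeapfrogEnergyError`).

* §3 **`su2LeapfrogStep_apply`** — the engine's step, read off: `(q, p) ↦ (e_ε(p₁)·q, p₁ + g(e_ε(p₁)·q))`,
  `p₁ = p + g(q)`; **`su2Leapfrog_energy_identity`** — `H(q',p') − H(q,p) = ½Σ_l⟪p₁,l, D(q)_l − D(q')_l⟫ +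
  [S(q') − S(q) − Σ_l⟪D(q)_l, p₁,l⟫] + κΣ_l(‖g(q')_l‖² − ‖g(q)_l‖²)` EXACTLY (the first-order terms cancel);
  `norm_su2HalfKick_apply_le` (`‖g(W)_l‖ ≤ D_max/(4κ)`); **`abs_su2Leapfrog_energy_error_le`** —
  `|H(q',p') − H(q,p)| ≤ K·‖p₁‖·|ε|·(8Σ_l‖p₁,l‖ + |ι|·D_max/κ)`: SECOND ORDER in the step size, linear in the
  number of links, every constant explicit;
* §4 `norm_su2HalfKick_le`, `su2LeapfrogStep_iterate_snd_le` (momentum growth: after `k` steps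
  `‖p_k‖ ≤ ‖p‖ + 2k·D_max/(4κ)`, `Σ‖p_k,l‖ ≤ Σ‖p_l‖ + 2k|ι|·D_max/(4κ)`), **`abs_su2LeapfrogN_energy_error_le`**
  (the `n`-step trajectory, `k ≤ N` steps: `≤ k·B_N`) and **`abs_su2LeapfrogProposalN_energy_error_le`** — THE
  ENERGY ERROR OF THE ENGINE'S PROPOSAL `sunLeapfrogProposalN pauliCoordι pauliCoordι_skew ε g n`, i.e. the
  quantity in the Metropolis test of `su2LeapfrogHMCN`:
  `≤ n·K·(‖p‖ + (2n+1)D_max/(4κ))·|ε|·(8(Σ_l‖p_l‖ + (2n+1)|ι|D_max/(4κ)) + |ι|D_max/κ)` — `O(nε²) = O(τε)` at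
  fixed trajectory length `τ = nε`; the acceptance probability is `≥ exp(−that)` pointwise.

NOT CLAIMED: the mean acceptance under the Gibbs law (a Gaussian moment of `Σ‖p_l‖`); optimal constants; the
instantiation for the two members (for the kernels of `SU2WilsonFlowLOExactForceFTHMCN`, half kick `−(ε'/2)Φ_κ`
and kinetic coefficient `κ'`, the kick is the consistent one iff `2κκ' = 1`) — a sequel; OMF words; floating
point; any number.
-/

noncomputable section

namespace Summit.Ventures.LatticeQCDFlow.Exactness

open Set Function MeasureTheory NormedSpace
open Literature.MathematicalPhysics.QuantumFieldTheory
open Literature.MathematicalPhysics.QuantumFieldTheory.Balaban1983to89.B10Eq18SigmaSU2Haar (expPauli)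
open scoped Matrix Matrix.Norms.Operator InnerProductSpace

set_option backward.isDefEq.respectTransparency false

variable {ι : Type*}

/-! ## §3 One leapfrog step of the engine's `SU(2)` kernel: the step read off, the energy identity for the consistent half kick, the second-order bound -/

section Step

variable [Fintype ι] [DecidableEq ι]

omit [Fintype ι] [DecidableEq ι] in
/-- **The engine's step `palindromicWord [kick g] (drift (mulDrift (su2ExpDrift ε)))` is kick–drift–kick**:
`(q, p) ↦ (e_ε(p₁)·q, p₁ + g(e_ε(p₁)·q))` with `p₁ = p + g(q)`. -/
theorem su2LeapfrogStep_apply (g : (ι → Matrix.specialUnitaryGroup (Fin 2) ℂ) → ι → EuclideanSpace ℝ (Fin 3)) (ε : ℝ)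
    (q : ι → Matrix.specialUnitaryGroup (Fin 2) ℂ) (p : ι → EuclideanSpace ℝ (Fin 3)) :
    palindromicWord [kick g] (drift (mulDrift (su2ExpDrift ε))) (q, p) =
      (su2ExpDrift ε (p + g q) * q, (p + g q) + g (su2ExpDrift ε (p + g q) * q)) := by
  simp only [palindromicWord, List.prod_cons, List.prod_nil, mul_one, List.reverse_singleton,
    Equiv.Perm.mul_apply]
  rfl

/-- **THE ENERGY IDENTITY FOR THE CONSISTENT HALF KICK `g = −D/(4κ)`** (`D = (fun (W : ι → Matrix.specialUnitaryGroup (Fin 2) ℂ) (l : ι) => WithLp.toLp 2 (fun i : Fin 3 => fderiv ℝ (fun a : ι → EuclideanSpace ℝ (Fin 3) => S (su2ExpDrift ε a * W)) 0 (Pi.single l (EuclideanSpace.single i (1 : ℝ)))))`, `H = S + κΣ‖p_l‖²`):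
with `p₁ = p + g(q)`, `q' = e_ε(p₁)·q`, `p' = p₁ + g(q')`,
`H(q',p') − H(q,p) = ½Σ_l ⟪p₁,l, D(q)_l − D(q')_l⟫ + [S(q') − S(q) − Σ_l ⟪D(q)_l, p₁,l⟫] + κΣ_l (‖g(q')_l‖² − ‖g(q)_l‖²)`
— the first-order terms cancel exactly. -/
theorem su2Leapfrog_energy_identity (S : (ι → Matrix.specialUnitaryGroup (Fin 2) ℂ) → ℝ) (ε κ : ℝ) (hκ : κ ≠ 0)
    (q : ι → Matrix.specialUnitaryGroup (Fin 2) ℂ) (p : ι → EuclideanSpace ℝ (Fin 3)) :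
    (S (su2ExpDrift ε (p + (fun (W : ι → Matrix.specialUnitaryGroup (Fin 2) ℂ) (l : ι) => -(1 / (4 * κ)) • (fun (W : ι → Matrix.specialUnitaryGroup (Fin 2) ℂ) (l : ι) => WithLp.toLp 2 (fun i : Fin 3 => fderiv ℝ (fun a : ι → EuclideanSpace ℝ (Fin 3) => S (su2ExpDrift ε a * W)) 0 (Pi.single l (EuclideanSpace.single i (1 : ℝ))))) W l) q) * q) +
        su2Kinetic κ ((p + (fun (W : ι → Matrix.specialUnitaryGroup (Fin 2) ℂ) (l : ι) => -(1 / (4 * κ)) • (fun (W : ι → Matrix.specialUnitaryGroup (Fin 2) ℂ) (l : ι) => WithLp.toLp 2 (fun i : Fin 3 => fderiv ℝ (fun a : ι → EuclideanSpace ℝ (Fin 3) => S (su2ExpDrift ε a * W)) 0 (Pi.single l (EuclideanSpace.single i (1 : ℝ))))) W l) q) + (fun (W : ι → Matrix.specialUnitaryGroup (Fin 2) ℂ) (l : ι) => -(1 / (4 * κ)) • (fun (W : ι → Matrix.specialUnitaryGroup (Fin 2) ℂ) (l : ι) => WithLp.toLp 2 (fun i : Fin 3 => fderiv ℝ (fun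 a : ι → EuclideanSpace ℝ (Fin 3) => S (su2ExpDrift ε a * W)) 0 (Pi.single l (EuclideanSpace.single i (1 : ℝ))))) W l) (su2ExpDrift ε (p + (fun (W : ι → Matrix.specialUnitaryGroup (Fin 2) ℂ) (l : ι) => -(1 / (4 * κ)) • (fun (W : ι → Matrix.specialUnitaryGroup (Fin 2) ℂ) (l : ι) => WithLp.toLp 2 (fun i : Fin 3 => fderiv ℝ (fun a : ι → EuclideanSpace ℝ (Fin 3) => S (su2ExpDrift ε a * W)) 0 (Pi.single l (EuclideanSpace.single i (1 : ℝ))))) W l) q) * q))) -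
      (S q + su2Kinetic κ p) =
      (1 / 2) * ∑ l, ⟪(p + (fun (W : ι → Matrix.specialUnitaryGroup (Fin 2) ℂ) (l : ι) => -(1 / (4 * κ)) • (fun (W : ι → Matrix.specialUnitaryGroup (Fin 2) ℂ) (l : ι) => WithLp.toLp 2 (fun i : Fin 3 => fderiv ℝ (fun a : ι → EuclideanSpace ℝ (Fin 3) => S (su2ExpDrift ε a * W)) 0 (Pi.single l (EuclideanSpace.single i (1 : ℝ))))) W l) q) l, (fun (W : ι → Matrix.specialUnitaryGroup (Fin 2) ℂ) (l : ι) => WithLp.toLp 2 (fun i : Fin 3 => fderiv ℝ (fun a : ι → EuclideanSpace ℝ (Fin 3) => S (su2ExpDrift ε a * W)) 0 (Pi.single l (EuclideanSpace.single i (1 : ℝ))))) q l - (fun (W : ι → Matrix.specialUnitaryGroup (Fin 2) ℂ) (l : ι) => WithLp.toLp 2 (fun i : Fin 3 => fderiv ℝ (fun a : ι → EuclideanSpace ℝ (Fin 3) => S (su2ExpDrift ε a * W)) 0 (Pi.single l (EuclideanSpace.single i (1 : ℝ))))) (su2ExpDrift ε (p + (fun (W : ι → Matrix.specialUnitaryGroup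 (Fin 2) ℂ) (l : ι) => -(1 / (4 * κ)) • (fun (W : ι → Matrix.specialUnitaryGroup (Fin 2) ℂ) (l : ι) => WithLp.toLp 2 (fun i : Fin 3 => fderiv ℝ (fun a : ι → EuclideanSpace ℝ (Fin 3) => S (su2ExpDrift ε a * W)) 0 (Pi.single l (EuclideanSpace.single i (1 : ℝ))))) W l) q) * q) l⟫_ℝ +
        (S (su2ExpDrift ε (p + (fun (W : ι → Matrix.specialUnitaryGroup (Fin 2) ℂ) (l : ι) => -(1 / (4 * κ)) • (fun (W : ι → Matrix.specialUnitaryGroup (Fin 2) ℂ) (l : ι) => WithLp.toLp 2 (fun i : Fin 3 => fderiv ℝ (fun a : ι → EuclideanSpace ℝ (Fin 3) => S (su2ExpDrift ε a * W)) 0 (Pi.single l (EuclideanSpace.single i (1 : ℝ))))) W l) q) * q) - S q - ∑ l, ⟪(fun (W : ι → Matrix.specialUnitaryGroup (Fin 2) ℂ) (l : ι) => WithLp.toLp 2 (fun i : Fin 3 => fderiv ℝ (fun a : ι → EuclideanSpace ℝ (Fin 3) => S (su2ExpDrift ε a * W)) 0 (Pi.single l (EuclideanSpace.single i (1 : ℝ)))))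 q l, (p + (fun (W : ι → Matrix.specialUnitaryGroup (Fin 2) ℂ) (l : ι) => -(1 / (4 * κ)) • (fun (W : ι → Matrix.specialUnitaryGroup (Fin 2) ℂ) (l : ι) => WithLp.toLp 2 (fun i : Fin 3 => fderiv ℝ (fun a : ι → EuclideanSpace ℝ (Fin 3) => S (su2ExpDrift ε a * W)) 0 (Pi.single l (EuclideanSpace.single i (1 : ℝ))))) W l) q) l⟫_ℝ) +
        κ * ∑ l, (‖(fun (W : ι → Matrix.specialUnitaryGroup (Fin 2) ℂ) (l : ι) => -(1 / (4 * κ)) • (fun (W : ι → Matrix.specialUnitaryGroup (Fin 2) ℂ) (l : ι) => WithLp.toLp 2 (fun i : Fin 3 => fderiv ℝ (fun a : ι → EuclideanSpace ℝ (Fin 3) => S (su2ExpDrift ε a * W)) 0 (Pi.single l (EuclideanSpace.single i (1 : ℝ))))) W l) (su2ExpDrift ε (p + (fun (W : ι → Matrix.specialUnitaryGroup (Fin 2) ℂ) (l : ι) => -(1 / (4 * κ)) • (fun (W : ι → Matrix.specialUnitaryGroup (Fin 2) ℂ) (l : ι) => WithLp.toLp 2 (fun i : Fin 3 => fderiv ℝ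 (fun a : ι → EuclideanSpace ℝ (Fin 3) => S (su2ExpDrift ε a * W)) 0 (Pi.single l (EuclideanSpace.single i (1 : ℝ))))) W l) q) * q) l‖ ^ 2 - ‖(fun (W : ι → Matrix.specialUnitaryGroup (Fin 2) ℂ) (l : ι) => -(1 / (4 * κ)) • (fun (W : ι → Matrix.specialUnitaryGroup (Fin 2) ℂ) (l : ι) => WithLp.toLp 2 (fun i : Fin 3 => fderiv ℝ (fun a : ι → EuclideanSpace ℝ (Fin 3) => S (su2ExpDrift ε a * W)) 0 (Pi.single l (EuclideanSpace.single i (1 : ℝ))))) W l) q l‖ ^ 2) := by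
  set D := (fun (W : ι → Matrix.specialUnitaryGroup (Fin 2) ℂ) (l : ι) => WithLp.toLp 2 (fun i : Fin 3 => fderiv ℝ (fun a : ι → EuclideanSpace ℝ (Fin 3) => S (su2ExpDrift ε a * W)) 0 (Pi.single l (EuclideanSpace.single i (1 : ℝ))))) with hD
  set g := (fun (W : ι → Matrix.specialUnitaryGroup (Fin 2) ℂ) (l : ι) => -(1 / (4 * κ)) • (fun (W : ι → Matrix.specialUnitaryGroup (Fin 2) ℂ) (l : ι) => WithLp.toLp 2 (fun i : Fin 3 => fderiv ℝ (fun a : ι → EuclideanSpace ℝ (Fin 3) => S (su2ExpDrift ε a * W)) 0 (Pi.single l (EuclideanSpace.single i (1 : ℝ))))) W l) with hg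
  set p₁ := p + g q with hp₁
  set q' := su2ExpDrift ε p₁ * q with hq'
  have hp : p = p₁ - g q := by rw [hp₁, add_sub_cancel_right]
  have hgW : ∀ W l, g W l = -(1 / (4 * κ)) • D W l := fun W l => by rw [hg]
  simp only [su2Kinetic]
  rw [hp]
  have key : ∀ l, κ * (‖p₁ l + g q' l‖ ^ 2 - ‖(p₁ - g q) l‖ ^ 2) =
      (1 / 2) * ⟪p₁ l, D q l - D q' l⟫_ℝ - ⟪D q l, p₁ l⟫_ℝ + κ * (‖g q' l‖ ^ 2 - ‖g q l‖ ^ 2) := by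
    intro l
    have h1 : ⟪p₁ l, g q' l⟫_ℝ = -(1 / (4 * κ)) * ⟪p₁ l, D q' l⟫_ℝ := by rw [hgW, inner_smul_right]
    have h2 : ⟪p₁ l, g q l⟫_ℝ = -(1 / (4 * κ)) * ⟪p₁ l, D q l⟫_ℝ := by rw [hgW, inner_smul_right]
    rw [Pi.sub_apply, norm_add_sq_real, norm_sub_sq_real, h1, h2, inner_sub_right, real_inner_comm (p₁ l) (D q l)]
    field_simp
    ring
  have hsum : κ * ∑ l, (‖p₁ l + g q' l‖ ^ 2 - ‖(p₁ - g q) l‖ ^ 2) =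
      (1 / 2) * ∑ l, ⟪p₁ l, D q l - D q' l⟫_ℝ - ∑ l, ⟪D q l, p₁ l⟫_ℝ + κ * ∑ l, (‖g q' l‖ ^ 2 - ‖g q l‖ ^ 2) := by
    rw [Finset.mul_sum, Finset.mul_sum, Finset.mul_sum, ← Finset.sum_sub_distrib, ← Finset.sum_add_distrib]
    exact Finset.sum_congr rfl fun l _ => key l
  have hsplit : κ * ∑ l, ‖(p₁ + g q') l‖ ^ 2 - κ * ∑ l, ‖(p₁ - g q) l‖ ^ 2 =
      κ * ∑ l, (‖p₁ l + g q' l‖ ^ 2 - ‖(p₁ - g q) l‖ ^ 2) := by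
    rw [Finset.sum_sub_distrib, mul_sub]
    rfl
  linarith [hsum, hsplit]

omit [Fintype ι] in
/-- The consistent half kick is bounded by `D_max/(4κ)` linkwise. -/
theorem norm_su2HalfKick_apply_le (S : (ι → Matrix.specialUnitaryGroup (Fin 2) ℂ) → ℝ) (ε κ : ℝ) (hκ : 0 < κ) {Dmax : ℝ}
    (hDb : ∀ (W : ι → Matrix.specialUnitaryGroup (Fin 2) ℂ) (l : ι), ‖(fun (W : ι → Matrix.specialUnitaryGroup (Fin 2) ℂ) (l : ι) => WithLp.toLp 2 (fun i : Fin 3 => fderiv ℝ (fun a : ι → EuclideanSpace ℝ (Fin 3) => S (su2ExpDrift ε a * W)) 0 (Pi.single l (EuclideanSpace.single i (1 : ℝ))))) W l‖ ≤ Dmax)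
    (W : ι → Matrix.specialUnitaryGroup (Fin 2) ℂ) (l : ι) : ‖(fun (W : ι → Matrix.specialUnitaryGroup (Fin 2) ℂ) (l : ι) => -(1 / (4 * κ)) • (fun (W : ι → Matrix.specialUnitaryGroup (Fin 2) ℂ) (l : ι) => WithLp.toLp 2 (fun i : Fin 3 => fderiv ℝ (fun a : ι → EuclideanSpace ℝ (Fin 3) => S (su2ExpDrift ε a * W)) 0 (Pi.single l (EuclideanSpace.single i (1 : ℝ))))) W l) W l‖ ≤ Dmax / (4 * κ) := by
  have hq : (0 : ℝ) < 1 / (4 * κ) := by positivity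
  simp only [norm_smul, norm_neg, Real.norm_eq_abs, abs_of_pos hq]
  calc 1 / (4 * κ) * ‖(fun (W : ι → Matrix.specialUnitaryGroup (Fin 2) ℂ) (l : ι) => WithLp.toLp 2 (fun i : Fin 3 => fderiv ℝ (fun a : ι → EuclideanSpace ℝ (Fin 3) => S (su2ExpDrift ε a * W)) 0 (Pi.single l (EuclideanSpace.single i (1 : ℝ))))) W l‖ ≤ 1 / (4 * κ) * Dmax := by gcongr; exact hDb W l
    _ = Dmax / (4 * κ) := by ring

/-- **THE ENERGY ERROR OF ONE LEAPFROG STEP OF THE `SU(2)` KERNEL IS SECOND ORDER, EXPLICITLY**: if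
`a ↦ S(e_ε(a)·W)` is differentiable at `0` for every `W`, `‖D(W)_l‖ ≤ D_max`, and `D` is `K`-Lipschitz in
the matrix sup norm, then for the consistent half kick `g = −D/(4κ)` (`κ > 0`), with `p₁ = p + g(q)`:
`|H(q',p') − H(q,p)| ≤ K·‖p₁‖·|ε|·(8Σ_l‖p₁,l‖ + |ι|·D_max/κ)`. -/
theorem abs_su2Leapfrog_energy_error_le (S : (ι → Matrix.specialUnitaryGroup (Fin 2) ℂ) → ℝ) (ε κ : ℝ) (hκ : 0 < κ)
    (hd : ∀ W : ι → Matrix.specialUnitaryGroup (Fin 2) ℂ,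
      DifferentiableAt ℝ (fun a : ι → EuclideanSpace ℝ (Fin 3) => S (su2ExpDrift ε a * W)) 0)
    {Dmax K : ℝ} (hD0 : 0 ≤ Dmax) (hK0 : 0 ≤ K)
    (hDb : ∀ (W : ι → Matrix.specialUnitaryGroup (Fin 2) ℂ) (l : ι), ‖(fun (W : ι → Matrix.specialUnitaryGroup (Fin 2) ℂ) (l : ι) => WithLp.toLp 2 (fun i : Fin 3 => fderiv ℝ (fun a : ι → EuclideanSpace ℝ (Fin 3) => S (su2ExpDrift ε a * W)) 0 (Pi.single l (EuclideanSpace.single i (1 : ℝ))))) W l‖ ≤ Dmax)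
    (hDK : ∀ W W' : ι → Matrix.specialUnitaryGroup (Fin 2) ℂ, ‖(fun (W : ι → Matrix.specialUnitaryGroup (Fin 2) ℂ) (l : ι) => WithLp.toLp 2 (fun i : Fin 3 => fderiv ℝ (fun a : ι → EuclideanSpace ℝ (Fin 3) => S (su2ExpDrift ε a * W)) 0 (Pi.single l (EuclideanSpace.single i (1 : ℝ))))) W - (fun (W : ι → Matrix.specialUnitaryGroup (Fin 2) ℂ) (l : ι) => WithLp.toLp 2 (fun i : Fin 3 => fderiv ℝ (fun a : ι → EuclideanSpace ℝ (Fin 3) => S (su2ExpDrift ε a * W)) 0 (Pi.single l (EuclideanSpace.single i (1 : ℝ))))) W'‖ ≤ K * ‖coeConfig W - coeConfig W'‖)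
    (q : ι → Matrix.specialUnitaryGroup (Fin 2) ℂ) (p : ι → EuclideanSpace ℝ (Fin 3)) :
    |(S (su2ExpDrift ε (p + (fun (W : ι → Matrix.specialUnitaryGroup (Fin 2) ℂ) (l : ι) => -(1 / (4 * κ)) • (fun (W : ι → Matrix.specialUnitaryGroup (Fin 2) ℂ) (l : ι) => WithLp.toLp 2 (fun i : Fin 3 => fderiv ℝ (fun a : ι → EuclideanSpace ℝ (Fin 3) => S (su2ExpDrift ε a * W)) 0 (Pi.single l (EuclideanSpace.single i (1 : ℝ))))) W l) q) * q) +
        su2Kinetic κ ((p + (fun (W : ι → Matrix.specialUnitaryGroup (Fin 2) ℂ) (l : ι) => -(1 / (4 * κ)) • (fun (W : ι → Matrix.specialUnitaryGroup (Fin 2) ℂ) (l : ι) => WithLp.toLp 2 (fun i : Fin 3 => fderiv ℝ (fun a : ι → EuclideanSpace ℝ (Fin 3) => S (su2ExpDrift ε a * W)) 0 (Pi.single l (EuclideanSpace.single i (1 : ℝ))))) W l) q) + (fun (W : ι → Matrix.specialUnitaryGroup (Fin 2) ℂ) (l : ι) => -(1 / (4 * κ)) • (fun (W : ι → Matrix.specialUnitaryGroup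 (Fin 2) ℂ) (l : ι) => WithLp.toLp 2 (fun i : Fin 3 => fderiv ℝ (fun a : ι → EuclideanSpace ℝ (Fin 3) => S (su2ExpDrift ε a * W)) 0 (Pi.single l (EuclideanSpace.single i (1 : ℝ))))) W l) (su2ExpDrift ε (p + (fun (W : ι → Matrix.specialUnitaryGroup (Fin 2) ℂ) (l : ι) => -(1 / (4 * κ)) • (fun (W : ι → Matrix.specialUnitaryGroup (Fin 2) ℂ) (l : ι) => WithLp.toLp 2 (fun i : Fin 3 => fderiv ℝ (fun a : ι → EuclideanSpace ℝ (Fin 3) => S (su2ExpDrift ε a * W)) 0 (Pi.single l (EuclideanSpace.single i (1 : ℝ))))) W l) q) * q))) -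
      (S q + su2Kinetic κ p)| ≤
      K * ‖p + (fun (W : ι → Matrix.specialUnitaryGroup (Fin 2) ℂ) (l : ι) => -(1 / (4 * κ)) • (fun (W : ι → Matrix.specialUnitaryGroup (Fin 2) ℂ) (l : ι) => WithLp.toLp 2 (fun i : Fin 3 => fderiv ℝ (fun a : ι → EuclideanSpace ℝ (Fin 3) => S (su2ExpDrift ε a * W)) 0 (Pi.single l (EuclideanSpace.single i (1 : ℝ))))) W l) q‖ * |ε| * (8 * ∑ l, ‖(p + (fun (W : ι → Matrix.specialUnitaryGroup (Fin 2) ℂ) (l : ι) => -(1 / (4 * κ)) • (fun (W : ι → Matrix.specialUnitaryGroup (Fin 2) ℂ) (l : ι) => WithLp.toLp 2 (fun i : Fin 3 => fderiv ℝ (fun a : ι → EuclideanSpace ℝ (Fin 3) => S (su2ExpDrift ε a * W)) 0 (Pi.single l (EuclideanSpace.single i (1 : ℝ))))) W l) q) l‖ + Fintype.card ι * Dmax / κ) := by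
  rw [su2Leapfrog_energy_identity S ε κ hκ.ne' q p]
  set D := (fun (W : ι → Matrix.specialUnitaryGroup (Fin 2) ℂ) (l : ι) => WithLp.toLp 2 (fun i : Fin 3 => fderiv ℝ (fun a : ι → EuclideanSpace ℝ (Fin 3) => S (su2ExpDrift ε a * W)) 0 (Pi.single l (EuclideanSpace.single i (1 : ℝ))))) with hD
  set g := (fun (W : ι → Matrix.specialUnitaryGroup (Fin 2) ℂ) (l : ι) => -(1 / (4 * κ)) • (fun (W : ι → Matrix.specialUnitaryGroup (Fin 2) ℂ) (l : ι) => WithLp.toLp 2 (fun i : Fin 3 => fderiv ℝ (fun a : ι → EuclideanSpace ℝ (Fin 3) => S (su2ExpDrift ε a * W)) 0 (Pi.single l (EuclideanSpace.single i (1 : ℝ))))) W l) with hg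
  set p₁ := p + g q with hp₁
  set q' := su2ExpDrift ε p₁ * q with hq'
  have hgW : ∀ W l, g W l = -(1 / (4 * κ)) • D W l := fun W l => by rw [hg]
  -- the drift moves the field by at most 8|ε|·‖p₁‖ in the matrix sup norm
  have hdist : ‖coeConfig q - coeConfig q'‖ ≤ 8 * |ε| * ‖p₁‖ := by
    have h := norm_coeConfig_su2ExpDrift_sub_le ε q p₁ 0 1
    rw [zero_smul, su2ExpDrift_zero, one_mul, one_smul, zero_sub, abs_neg, abs_one, mul_one] at h
    exact h
  have hDl : ∀ l, ‖D q l - D q' l‖ ≤ K * (8 * |ε| * ‖p₁‖) := fun l =>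
    ((norm_le_pi_norm (D q - D q') l).trans (hDK q q')).trans (mul_le_mul_of_nonneg_left hdist hK0)
  -- term 1: ½ Σ ⟪p₁, D q − D q'⟫
  have h1 : |(1 / 2) * ∑ l, ⟪p₁ l, D q l - D q' l⟫_ℝ| ≤ (1 / 2) * (8 * K * ‖p₁‖ * |ε| * ∑ l, ‖p₁ l‖) := by
    rw [abs_mul, abs_of_pos (by norm_num : (0 : ℝ) < 1 / 2)]
    refine mul_le_mul_of_nonneg_left ?_ (by norm_num)
    refine (Finset.abs_sum_le_sum_abs _ _).trans ?_
    rw [Finset.mul_sum]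
    refine Finset.sum_le_sum fun l _ => ?_
    calc |⟪p₁ l, D q l - D q' l⟫_ℝ| ≤ ‖p₁ l‖ * ‖D q l - D q' l‖ := abs_real_inner_le_norm _ _
      _ ≤ ‖p₁ l‖ * (K * (8 * |ε| * ‖p₁‖)) := mul_le_mul_of_nonneg_left (hDl l) (norm_nonneg _)
      _ = 8 * K * ‖p₁‖ * |ε| * ‖p₁ l‖ := by ring
  -- term 2: the Taylor remainder of the potential (§2)
  have h2 : |S q' - S q - ∑ l, ⟪D q l, p₁ l⟫_ℝ| ≤ 4 * |ε| * K * ‖p₁‖ * ∑ l, ‖p₁ l‖ :=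
    abs_action_su2ExpDrift_sub_linear_le S ε hd hK0 hDK q p₁
  -- term 3: κ Σ (‖g(q')‖² − ‖g(q)‖²)
  have h3 : |κ * ∑ l, (‖g q' l‖ ^ 2 - ‖g q l‖ ^ 2)| ≤ Fintype.card ι * (K * ‖p₁‖ * |ε| * Dmax / κ) := by
    rw [abs_mul, abs_of_pos hκ]
    have hq4 : (0 : ℝ) < 1 / (4 * κ) := by positivity
    have hgb : ∀ W l, ‖g W l‖ ≤ Dmax / (4 * κ) := fun W l => by
      rw [hg]; exact norm_su2HalfKick_apply_le S ε κ hκ hDb W l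
    have hge : ∀ l, |‖g q' l‖ ^ 2 - ‖g q l‖ ^ 2| ≤ K * ‖p₁‖ * |ε| * Dmax / κ ^ 2 := by
      intro l
      rw [sq_sub_sq, abs_mul]
      have hsum : |‖g q' l‖ + ‖g q l‖| ≤ 2 * Dmax / (4 * κ) := by
        rw [abs_of_nonneg (by positivity)]
        calc ‖g q' l‖ + ‖g q l‖ ≤ Dmax / (4 * κ) + Dmax / (4 * κ) := add_le_add (hgb _ l) (hgb _ l)
          _ = 2 * Dmax / (4 * κ) := by ring
      have hdiff : |‖g q' l‖ - ‖g q l‖| ≤ K * (8 * |ε| * ‖p₁‖) / (4 * κ) := by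
        refine (abs_norm_sub_norm_le _ _).trans ?_
        rw [hgW, hgW, ← smul_sub, norm_smul, norm_neg, Real.norm_eq_abs, abs_of_pos hq4, norm_sub_rev]
        calc 1 / (4 * κ) * ‖D q l - D q' l‖ ≤ 1 / (4 * κ) * (K * (8 * |ε| * ‖p₁‖)) := by gcongr; exact hDl l
          _ = K * (8 * |ε| * ‖p₁‖) / (4 * κ) := by ring
      have L1 : ∀ P : ℝ, (2 * Dmax / (4 * κ)) * (K * (8 * |ε| * P) / (4 * κ)) = K * P * |ε| * Dmax / κ ^ 2 := by
        intro P; field_simp; ring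
      calc |‖g q' l‖ + ‖g q l‖| * |‖g q' l‖ - ‖g q l‖| ≤ (2 * Dmax / (4 * κ)) * (K * (8 * |ε| * ‖p₁‖) / (4 * κ)) :=
            mul_le_mul hsum hdiff (abs_nonneg _) (by positivity)
        _ = K * ‖p₁‖ * |ε| * Dmax / κ ^ 2 := L1 _
    calc κ * |∑ l, (‖g q' l‖ ^ 2 - ‖g q l‖ ^ 2)| ≤ κ * ∑ l, |‖g q' l‖ ^ 2 - ‖g q l‖ ^ 2| :=
          mul_le_mul_of_nonneg_left (Finset.abs_sum_le_sum_abs _ _) hκ.le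
      _ ≤ κ * ∑ _l : ι, K * ‖p₁‖ * |ε| * Dmax / κ ^ 2 :=
          mul_le_mul_of_nonneg_left (Finset.sum_le_sum fun l _ => hge l) hκ.le
      _ = Fintype.card ι * (K * ‖p₁‖ * |ε| * Dmax / κ) := by
          have L2 : ∀ n P : ℝ, κ * (n * (K * P * |ε| * Dmax / κ ^ 2)) = n * (K * P * |ε| * Dmax / κ) := by
            intro n P; field_simp
          rw [Finset.sum_const, Finset.card_univ, nsmul_eq_mul]
          exact L2 _ _
  -- assemble
  calc |(1 / 2) * ∑ l, ⟪p₁ l, D q l - D q' l⟫_ℝ + (S q' - S q - ∑ l, ⟪D q l, p₁ l⟫_ℝ) + κ * ∑ l, (‖g q' l‖ ^ 2 - ‖g q l‖ ^ 2)|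
      ≤ |(1 / 2) * ∑ l, ⟪p₁ l, D q l - D q' l⟫_ℝ| + |S q' - S q - ∑ l, ⟪D q l, p₁ l⟫_ℝ| + |κ * ∑ l, (‖g q' l‖ ^ 2 - ‖g q l‖ ^ 2)| :=
        abs_add_three _ _ _
    _ ≤ (1 / 2) * (8 * K * ‖p₁‖ * |ε| * ∑ l, ‖p₁ l‖) + 4 * |ε| * K * ‖p₁‖ * (∑ l, ‖p₁ l‖) +
          Fintype.card ι * (K * ‖p₁‖ * |ε| * Dmax / κ) := add_le_add (add_le_add h1 h2) h3
    _ = K * ‖p₁‖ * |ε| * (8 * ∑ l, ‖p₁ l‖ + Fintype.card ι * Dmax / κ) := by ring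

end Step

/-! ## §4 The whole trajectory: `n` steps, momentum growth, and the energy error of the engine's `n`-step proposal -/

section Trajectory

variable [Fintype ι] [DecidableEq ι]

/-- The consistent half kick is bounded by `D_max/(4κ)` in the sup norm. -/
theorem norm_su2HalfKick_le (S : (ι → Matrix.specialUnitaryGroup (Fin 2) ℂ) → ℝ) (ε κ : ℝ) (hκ : 0 < κ) {Dmax : ℝ}
    (hD0 : 0 ≤ Dmax) (hDb : ∀ (W : ι → Matrix.specialUnitaryGroup (Fin 2) ℂ) (l : ι), ‖(fun (W : ι → Matrix.specialUnitaryGroup (Fin 2) ℂ) (l : ι) => WithLp.toLp 2 (fun i : Fin 3 => fderiv ℝ (fun a : ι → EuclideanSpace ℝ (Fin 3) => S (su2ExpDrift ε a * W)) 0 (Pi.single l (EuclideanSpace.single i (1 : ℝ))))) W l‖ ≤ Dmax)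
    (W : ι → Matrix.specialUnitaryGroup (Fin 2) ℂ) : ‖(fun (W : ι → Matrix.specialUnitaryGroup (Fin 2) ℂ) (l : ι) => -(1 / (4 * κ)) • (fun (W : ι → Matrix.specialUnitaryGroup (Fin 2) ℂ) (l : ι) => WithLp.toLp 2 (fun i : Fin 3 => fderiv ℝ (fun a : ι → EuclideanSpace ℝ (Fin 3) => S (su2ExpDrift ε a * W)) 0 (Pi.single l (EuclideanSpace.single i (1 : ℝ))))) W l) W‖ ≤ Dmax / (4 * κ) :=
  (pi_norm_le_iff_of_nonneg (by positivity)).2 fun l => norm_su2HalfKick_apply_le S ε κ hκ hDb W l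

/-- **Momentum growth along the trajectory**: after `k` steps the sup norm of the momentum has grown by at
most `2k·D_max/(4κ)` and `Σ_l ‖p_l‖` by at most `2k·|ι|·D_max/(4κ)`. -/
theorem su2LeapfrogStep_iterate_snd_le (S : (ι → Matrix.specialUnitaryGroup (Fin 2) ℂ) → ℝ) (ε κ : ℝ) (hκ : 0 < κ)
    {Dmax : ℝ} (hD0 : 0 ≤ Dmax) (hDb : ∀ (W : ι → Matrix.specialUnitaryGroup (Fin 2) ℂ) (l : ι), ‖(fun (W : ι → Matrix.specialUnitaryGroup (Fin 2) ℂ) (l : ι) => WithLp.toLp 2 (fun i : Fin 3 => fderiv ℝ (fun a : ι → EuclideanSpace ℝ (Fin 3) => S (su2ExpDrift ε a * W)) 0 (Pi.single l (EuclideanSpace.single i (1 : ℝ))))) W l‖ ≤ Dmax)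
    (q : ι → Matrix.specialUnitaryGroup (Fin 2) ℂ) (p : ι → EuclideanSpace ℝ (Fin 3)) (k : ℕ) :
    ‖((⇑(palindromicWord [kick (fun (W : ι → Matrix.specialUnitaryGroup (Fin 2) ℂ) (l : ι) => -(1 / (4 * κ)) • (fun (W : ι → Matrix.specialUnitaryGroup (Fin 2) ℂ) (l : ι) => WithLp.toLp 2 (fun i : Fin 3 => fderiv ℝ (fun a : ι → EuclideanSpace ℝ (Fin 3) => S (su2ExpDrift ε a * W)) 0 (Pi.single l (EuclideanSpace.single i (1 : ℝ))))) W l)] (drift (mulDrift (su2ExpDrift ε)))))^[k] (q, p)).2‖ ≤ ‖p‖ + 2 * k * (Dmax / (4 * κ)) ∧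
      ∑ l, ‖((⇑(palindromicWord [kick (fun (W : ι → Matrix.specialUnitaryGroup (Fin 2) ℂ) (l : ι) => -(1 / (4 * κ)) • (fun (W : ι → Matrix.specialUnitaryGroup (Fin 2) ℂ) (l : ι) => WithLp.toLp 2 (fun i : Fin 3 => fderiv ℝ (fun a : ι → EuclideanSpace ℝ (Fin 3) => S (su2ExpDrift ε a * W)) 0 (Pi.single l (EuclideanSpace.single i (1 : ℝ))))) W l)] (drift (mulDrift (su2ExpDrift ε)))))^[k] (q, p)).2 l‖ ≤
        ∑ l, ‖p l‖ + 2 * k * (Fintype.card ι * (Dmax / (4 * κ))) := by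
  have hg := norm_su2HalfKick_le S ε κ hκ hD0 hDb
  have hge := norm_su2HalfKick_apply_le S ε κ hκ hDb
  induction k with
  | zero => simp
  | succ k ih =>
    rw [Function.iterate_succ_apply']
    set z := (⇑(palindromicWord [kick (fun (W : ι → Matrix.specialUnitaryGroup (Fin 2) ℂ) (l : ι) => -(1 / (4 * κ)) • (fun (W : ι → Matrix.specialUnitaryGroup (Fin 2) ℂ) (l : ι) => WithLp.toLp 2 (fun i : Fin 3 => fderiv ℝ (fun a : ι → EuclideanSpace ℝ (Fin 3) => S (su2ExpDrift ε a * W)) 0 (Pi.single l (EuclideanSpace.single i (1 : ℝ))))) W l)] (drift (mulDrift (su2ExpDrift ε)))))^[k] (q, p) with hz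
    obtain ⟨ih1, ih2⟩ := ih
    have hstep := su2LeapfrogStep_apply (fun (W : ι → Matrix.specialUnitaryGroup (Fin 2) ℂ) (l : ι) => -(1 / (4 * κ)) • (fun (W : ι → Matrix.specialUnitaryGroup (Fin 2) ℂ) (l : ι) => WithLp.toLp 2 (fun i : Fin 3 => fderiv ℝ (fun a : ι → EuclideanSpace ℝ (Fin 3) => S (su2ExpDrift ε a * W)) 0 (Pi.single l (EuclideanSpace.single i (1 : ℝ))))) W l) ε z.1 z.2
    rw [Prod.mk.eta] at hstep
    rw [hstep]
    constructor
    · calc ‖z.2 + (fun (W : ι → Matrix.specialUnitaryGroup (Fin 2) ℂ) (l : ι) => -(1 / (4 * κ)) • (fun (W : ι → Matrix.specialUnitaryGroup (Fin 2) ℂ) (l : ι) => WithLp.toLp 2 (fun i : Fin 3 => fderiv ℝ (fun a : ι → EuclideanSpace ℝ (Fin 3) => S (su2ExpDrift ε a * W)) 0 (Pi.single l (EuclideanSpace.single i (1 : ℝ))))) W l) z.1 + (fun (W : ι → Matrix.specialUnitaryGroup (Fin 2) ℂ) (l : ι) => -(1 / (4 * κ)) • (fun (W : ι → Matrix.specialUnitaryGroup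 (Fin 2) ℂ) (l : ι) => WithLp.toLp 2 (fun i : Fin 3 => fderiv ℝ (fun a : ι → EuclideanSpace ℝ (Fin 3) => S (su2ExpDrift ε a * W)) 0 (Pi.single l (EuclideanSpace.single i (1 : ℝ))))) W l) (su2ExpDrift ε (z.2 + (fun (W : ι → Matrix.specialUnitaryGroup (Fin 2) ℂ) (l : ι) => -(1 / (4 * κ)) • (fun (W : ι → Matrix.specialUnitaryGroup (Fin 2) ℂ) (l : ι) => WithLp.toLp 2 (fun i : Fin 3 => fderiv ℝ (fun a : ι → EuclideanSpace ℝ (Fin 3) => S (su2ExpDrift ε a * W)) 0 (Pi.single l (EuclideanSpace.single i (1 : ℝ))))) W l) z.1) * z.1)‖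
          ≤ ‖z.2‖ + ‖(fun (W : ι → Matrix.specialUnitaryGroup (Fin 2) ℂ) (l : ι) => -(1 / (4 * κ)) • (fun (W : ι → Matrix.specialUnitaryGroup (Fin 2) ℂ) (l : ι) => WithLp.toLp 2 (fun i : Fin 3 => fderiv ℝ (fun a : ι → EuclideanSpace ℝ (Fin 3) => S (su2ExpDrift ε a * W)) 0 (Pi.single l (EuclideanSpace.single i (1 : ℝ))))) W l) z.1‖ + ‖(fun (W : ι → Matrix.specialUnitaryGroup (Fin 2) ℂ) (l : ι) => -(1 / (4 * κ)) • (fun (W : ι → Matrix.specialUnitaryGroup (Fin 2) ℂ) (l : ι) => WithLp.toLp 2 (fun i : Fin 3 => fderiv ℝ (fun a : ι → EuclideanSpace ℝ (Fin 3) => S (su2ExpDrift ε a * W)) 0 (Pi.single l (EuclideanSpace.single i (1 : ℝ))))) W l) (su2ExpDrift ε (z.2 + (fun (W : ι → Matrix.specialUnitaryGroup (Fin 2) ℂ) (l : ι) => -(1 / (4 * κ)) • (fun (W : ι → Matrix.specialUnitaryGroup (Fin 2) ℂ) (l : ι) => WithLp.toLp 2 (fun i : Fin 3 => fderiv ℝ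 (fun a : ι → EuclideanSpace ℝ (Fin 3) => S (su2ExpDrift ε a * W)) 0 (Pi.single l (EuclideanSpace.single i (1 : ℝ))))) W l) z.1) * z.1)‖ :=
            (norm_add_le _ _).trans (add_le_add (norm_add_le _ _) le_rfl)
        _ ≤ (‖p‖ + 2 * k * (Dmax / (4 * κ))) + Dmax / (4 * κ) + Dmax / (4 * κ) := add_le_add (add_le_add ih1 (hg _)) (hg _)
        _ = ‖p‖ + 2 * ((k + 1 : ℕ) : ℝ) * (Dmax / (4 * κ)) := by push_cast; ring
    · calc ∑ l, ‖(z.2 + (fun (W : ι → Matrix.specialUnitaryGroup (Fin 2) ℂ) (l : ι) => -(1 / (4 * κ)) • (fun (W : ι → Matrix.specialUnitaryGroup (Fin 2) ℂ) (l : ι) => WithLp.toLp 2 (fun i : Fin 3 => fderiv ℝ (fun a : ι → EuclideanSpace ℝ (Fin 3) => S (su2ExpDrift ε a * W)) 0 (Pi.single l (EuclideanSpace.single i (1 : ℝ))))) W l) z.1 + (fun (W : ι → Matrix.specialUnitaryGroup (Fin 2) ℂ) (l : ι) => -(1 / (4 * κ)) • (fun (W : ι → Matrix.specialUnitaryGroup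 (Fin 2) ℂ) (l : ι) => WithLp.toLp 2 (fun i : Fin 3 => fderiv ℝ (fun a : ι → EuclideanSpace ℝ (Fin 3) => S (su2ExpDrift ε a * W)) 0 (Pi.single l (EuclideanSpace.single i (1 : ℝ))))) W l) (su2ExpDrift ε (z.2 + (fun (W : ι → Matrix.specialUnitaryGroup (Fin 2) ℂ) (l : ι) => -(1 / (4 * κ)) • (fun (W : ι → Matrix.specialUnitaryGroup (Fin 2) ℂ) (l : ι) => WithLp.toLp 2 (fun i : Fin 3 => fderiv ℝ (fun a : ι → EuclideanSpace ℝ (Fin 3) => S (su2ExpDrift ε a * W)) 0 (Pi.single l (EuclideanSpace.single i (1 : ℝ))))) W l) z.1) * z.1)) l‖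
          ≤ ∑ l, (‖z.2 l‖ + Dmax / (4 * κ) + Dmax / (4 * κ)) := by
            refine Finset.sum_le_sum fun l _ => ?_
            rw [Pi.add_apply, Pi.add_apply]
            exact (norm_add_le _ _).trans (add_le_add ((norm_add_le _ _).trans (add_le_add le_rfl (hge _ l))) (hge _ l))
        _ = ∑ l, ‖z.2 l‖ + 2 * (Fintype.card ι * (Dmax / (4 * κ))) := by
            rw [Finset.sum_add_distrib, Finset.sum_add_distrib, Finset.sum_const, Finset.card_univ, nsmul_eq_mul]; ring
        _ ≤ ∑ l, ‖p l‖ + 2 * ((k + 1 : ℕ) : ℝ) * (Fintype.card ι * (Dmax / (4 * κ))) := by push_cast; linarith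

/-- **THE ENERGY ERROR OF THE `n`-STEP TRAJECTORY**: for every `k ≤ N`,
`|H(wᵏ(q,p)) − H(q,p)| ≤ k · K·(‖p‖ + (2N+1)·D_max/(4κ))·|ε|·(8(Σ_l‖p_l‖ + (2N+1)·|ι|·D_max/(4κ)) + |ι|·D_max/κ)`
— linear in the number of steps, second order in the step size once `K, D_max = O(ε)`. -/
theorem abs_su2LeapfrogN_energy_error_le (S : (ι → Matrix.specialUnitaryGroup (Fin 2) ℂ) → ℝ) (ε κ : ℝ) (hκ : 0 < κ)
    (hd : ∀ W : ι → Matrix.specialUnitaryGroup (Fin 2) ℂ,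
      DifferentiableAt ℝ (fun a : ι → EuclideanSpace ℝ (Fin 3) => S (su2ExpDrift ε a * W)) 0)
    {Dmax K : ℝ} (hD0 : 0 ≤ Dmax) (hK0 : 0 ≤ K)
    (hDb : ∀ (W : ι → Matrix.specialUnitaryGroup (Fin 2) ℂ) (l : ι), ‖(fun (W : ι → Matrix.specialUnitaryGroup (Fin 2) ℂ) (l : ι) => WithLp.toLp 2 (fun i : Fin 3 => fderiv ℝ (fun a : ι → EuclideanSpace ℝ (Fin 3) => S (su2ExpDrift ε a * W)) 0 (Pi.single l (EuclideanSpace.single i (1 : ℝ))))) W l‖ ≤ Dmax)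
    (hDK : ∀ W W' : ι → Matrix.specialUnitaryGroup (Fin 2) ℂ, ‖(fun (W : ι → Matrix.specialUnitaryGroup (Fin 2) ℂ) (l : ι) => WithLp.toLp 2 (fun i : Fin 3 => fderiv ℝ (fun a : ι → EuclideanSpace ℝ (Fin 3) => S (su2ExpDrift ε a * W)) 0 (Pi.single l (EuclideanSpace.single i (1 : ℝ))))) W - (fun (W : ι → Matrix.specialUnitaryGroup (Fin 2) ℂ) (l : ι) => WithLp.toLp 2 (fun i : Fin 3 => fderiv ℝ (fun a : ι → EuclideanSpace ℝ (Fin 3) => S (su2ExpDrift ε a * W)) 0 (Pi.single l (EuclideanSpace.single i (1 : ℝ))))) W'‖ ≤ K * ‖coeConfig W - coeConfig W'‖)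
    (q : ι → Matrix.specialUnitaryGroup (Fin 2) ℂ) (p : ι → EuclideanSpace ℝ (Fin 3)) (N : ℕ) :
    ∀ k ≤ N, |(S ((⇑(palindromicWord [kick (fun (W : ι → Matrix.specialUnitaryGroup (Fin 2) ℂ) (l : ι) => -(1 / (4 * κ)) • (fun (W : ι → Matrix.specialUnitaryGroup (Fin 2) ℂ) (l : ι) => WithLp.toLp 2 (fun i : Fin 3 => fderiv ℝ (fun a : ι → EuclideanSpace ℝ (Fin 3) => S (su2ExpDrift ε a * W)) 0 (Pi.single l (EuclideanSpace.single i (1 : ℝ))))) W l)] (drift (mulDrift (su2ExpDrift ε)))))^[k] (q, p)).1 +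
        su2Kinetic κ ((⇑(palindromicWord [kick (fun (W : ι → Matrix.specialUnitaryGroup (Fin 2) ℂ) (l : ι) => -(1 / (4 * κ)) • (fun (W : ι → Matrix.specialUnitaryGroup (Fin 2) ℂ) (l : ι) => WithLp.toLp 2 (fun i : Fin 3 => fderiv ℝ (fun a : ι → EuclideanSpace ℝ (Fin 3) => S (su2ExpDrift ε a * W)) 0 (Pi.single l (EuclideanSpace.single i (1 : ℝ))))) W l)] (drift (mulDrift (su2ExpDrift ε)))))^[k] (q, p)).2) -
        (S q + su2Kinetic κ p)| ≤
      k * (K * (‖p‖ + (2 * N + 1) * (Dmax / (4 * κ))) * |ε| *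
        (8 * (∑ l, ‖p l‖ + (2 * N + 1) * (Fintype.card ι * (Dmax / (4 * κ)))) + Fintype.card ι * Dmax / κ)) := by
  have hg := norm_su2HalfKick_le S ε κ hκ hD0 hDb
  have hge := norm_su2HalfKick_apply_le S ε κ hκ hDb
  set B := K * (‖p‖ + (2 * N + 1) * (Dmax / (4 * κ))) * |ε| *
        (8 * (∑ l, ‖p l‖ + (2 * N + 1) * (Fintype.card ι * (Dmax / (4 * κ)))) + Fintype.card ι * Dmax / κ) with hB
  intro k
  induction k with
  | zero => intro _; simp
  | succ k ih =>
    intro hk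
    have hk' : k ≤ N := Nat.le_of_succ_le hk
    have hkN : (k : ℝ) + 1 ≤ N := by exact_mod_cast hk
    specialize ih hk'
    rw [Function.iterate_succ_apply']
    set z := (⇑(palindromicWord [kick (fun (W : ι → Matrix.specialUnitaryGroup (Fin 2) ℂ) (l : ι) => -(1 / (4 * κ)) • (fun (W : ι → Matrix.specialUnitaryGroup (Fin 2) ℂ) (l : ι) => WithLp.toLp 2 (fun i : Fin 3 => fderiv ℝ (fun a : ι → EuclideanSpace ℝ (Fin 3) => S (su2ExpDrift ε a * W)) 0 (Pi.single l (EuclideanSpace.single i (1 : ℝ))))) W l)] (drift (mulDrift (su2ExpDrift ε)))))^[k] (q, p) with hz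
    obtain ⟨hz1, hz2⟩ := su2LeapfrogStep_iterate_snd_le S ε κ hκ hD0 hDb q p k
    rw [← hz] at hz1 hz2
    -- one more step from z
    have hstep := abs_su2Leapfrog_energy_error_le S ε κ hκ hd hD0 hK0 hDb hDK z.1 z.2
    have happ := su2LeapfrogStep_apply (fun (W : ι → Matrix.specialUnitaryGroup (Fin 2) ℂ) (l : ι) => -(1 / (4 * κ)) • (fun (W : ι → Matrix.specialUnitaryGroup (Fin 2) ℂ) (l : ι) => WithLp.toLp 2 (fun i : Fin 3 => fderiv ℝ (fun a : ι → EuclideanSpace ℝ (Fin 3) => S (su2ExpDrift ε a * W)) 0 (Pi.single l (EuclideanSpace.single i (1 : ℝ))))) W l) ε z.1 z.2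
    rw [Prod.mk.eta] at happ
    rw [happ]
    simp only
    -- the momentum after the first half kick, and its norms
    have hn1 : ‖z.2 + (fun (W : ι → Matrix.specialUnitaryGroup (Fin 2) ℂ) (l : ι) => -(1 / (4 * κ)) • (fun (W : ι → Matrix.specialUnitaryGroup (Fin 2) ℂ) (l : ι) => WithLp.toLp 2 (fun i : Fin 3 => fderiv ℝ (fun a : ι → EuclideanSpace ℝ (Fin 3) => S (su2ExpDrift ε a * W)) 0 (Pi.single l (EuclideanSpace.single i (1 : ℝ))))) W l) z.1‖ ≤ ‖p‖ + (2 * N + 1) * (Dmax / (4 * κ)) := by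
      calc ‖z.2 + (fun (W : ι → Matrix.specialUnitaryGroup (Fin 2) ℂ) (l : ι) => -(1 / (4 * κ)) • (fun (W : ι → Matrix.specialUnitaryGroup (Fin 2) ℂ) (l : ι) => WithLp.toLp 2 (fun i : Fin 3 => fderiv ℝ (fun a : ι → EuclideanSpace ℝ (Fin 3) => S (su2ExpDrift ε a * W)) 0 (Pi.single l (EuclideanSpace.single i (1 : ℝ))))) W l) z.1‖ ≤ ‖z.2‖ + ‖(fun (W : ι → Matrix.specialUnitaryGroup (Fin 2) ℂ) (l : ι) => -(1 / (4 * κ)) • (fun (W : ι → Matrix.specialUnitaryGroup (Fin 2) ℂ) (l : ι) => WithLp.toLp 2 (fun i : Fin 3 => fderiv ℝ (fun a : ι → EuclideanSpace ℝ (Fin 3) => S (su2ExpDrift ε a * W)) 0 (Pi.single l (EuclideanSpace.single i (1 : ℝ))))) W l) z.1‖ := norm_add_le _ _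
        _ ≤ (‖p‖ + 2 * k * (Dmax / (4 * κ))) + Dmax / (4 * κ) := add_le_add hz1 (hg _)
        _ ≤ ‖p‖ + (2 * N + 1) * (Dmax / (4 * κ)) := by nlinarith [div_nonneg hD0 (by positivity : (0:ℝ) ≤ 4 * κ)]
    have hs1 : ∑ l, ‖(z.2 + (fun (W : ι → Matrix.specialUnitaryGroup (Fin 2) ℂ) (l : ι) => -(1 / (4 * κ)) • (fun (W : ι → Matrix.specialUnitaryGroup (Fin 2) ℂ) (l : ι) => WithLp.toLp 2 (fun i : Fin 3 => fderiv ℝ (fun a : ι → EuclideanSpace ℝ (Fin 3) => S (su2ExpDrift ε a * W)) 0 (Pi.single l (EuclideanSpace.single i (1 : ℝ))))) W l) z.1) l‖ ≤ ∑ l, ‖p l‖ + (2 * N + 1) * (Fintype.card ι * (Dmax / (4 * κ))) := by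
      calc ∑ l, ‖(z.2 + (fun (W : ι → Matrix.specialUnitaryGroup (Fin 2) ℂ) (l : ι) => -(1 / (4 * κ)) • (fun (W : ι → Matrix.specialUnitaryGroup (Fin 2) ℂ) (l : ι) => WithLp.toLp 2 (fun i : Fin 3 => fderiv ℝ (fun a : ι → EuclideanSpace ℝ (Fin 3) => S (su2ExpDrift ε a * W)) 0 (Pi.single l (EuclideanSpace.single i (1 : ℝ))))) W l) z.1) l‖ ≤ ∑ l, (‖z.2 l‖ + Dmax / (4 * κ)) := by
            refine Finset.sum_le_sum fun l _ => ?_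
            rw [Pi.add_apply]
            exact (norm_add_le _ _).trans (add_le_add le_rfl (hge _ l))
        _ = ∑ l, ‖z.2 l‖ + Fintype.card ι * (Dmax / (4 * κ)) := by
            rw [Finset.sum_add_distrib, Finset.sum_const, Finset.card_univ, nsmul_eq_mul]
        _ ≤ ∑ l, ‖p l‖ + (2 * N + 1) * (Fintype.card ι * (Dmax / (4 * κ))) := by
            nlinarith [hz2, mul_nonneg (Nat.cast_nonneg (Fintype.card ι)) (div_nonneg hD0 (by positivity : (0:ℝ) ≤ 4 * κ))]
    have hstep' : |(S (su2ExpDrift ε (z.2 + (fun (W : ι → Matrix.specialUnitaryGroup (Fin 2) ℂ) (l : ι) => -(1 / (4 * κ)) • (fun (W : ι → Matrix.specialUnitaryGroup (Fin 2) ℂ) (l : ι) => WithLp.toLp 2 (fun i : Fin 3 => fderiv ℝ (fun a : ι → EuclideanSpace ℝ (Fin 3) => S (su2ExpDrift ε a * W)) 0 (Pi.single l (EuclideanSpace.single i (1 : ℝ))))) W l) z.1) * z.1) +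
          su2Kinetic κ (z.2 + (fun (W : ι → Matrix.specialUnitaryGroup (Fin 2) ℂ) (l : ι) => -(1 / (4 * κ)) • (fun (W : ι → Matrix.specialUnitaryGroup (Fin 2) ℂ) (l : ι) => WithLp.toLp 2 (fun i : Fin 3 => fderiv ℝ (fun a : ι → EuclideanSpace ℝ (Fin 3) => S (su2ExpDrift ε a * W)) 0 (Pi.single l (EuclideanSpace.single i (1 : ℝ))))) W l) z.1 + (fun (W : ι → Matrix.specialUnitaryGroup (Fin 2) ℂ) (l : ι) => -(1 / (4 * κ)) • (fun (W : ι → Matrix.specialUnitaryGroup (Fin 2) ℂ) (l : ι) => WithLp.toLp 2 (fun i : Fin 3 => fderiv ℝ (fun a : ι → EuclideanSpace ℝ (Fin 3) => S (su2ExpDrift ε a * W)) 0 (Pi.single l (EuclideanSpace.single i (1 : ℝ))))) W l) (su2ExpDrift ε (z.2 + (fun (W : ι → Matrix.specialUnitaryGroup (Fin 2) ℂ) (l : ι) => -(1 / (4 * κ)) • (fun (W : ι → Matrix.specialUnitaryGroup (Fin 2) ℂ) (l : ι) => WithLp.toLp 2 (fun i : Fin 3 => fderiv ℝ (fun a : ι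 → EuclideanSpace ℝ (Fin 3) => S (su2ExpDrift ε a * W)) 0 (Pi.single l (EuclideanSpace.single i (1 : ℝ))))) W l) z.1) * z.1))) -
        (S z.1 + su2Kinetic κ z.2)| ≤ B := by
      refine hstep.trans ?_
      rw [hB]
      have hc0 : 0 ≤ Fintype.card ι * Dmax / κ := by positivity
      have hsum0 : 0 ≤ ∑ l, ‖(z.2 + (fun (W : ι → Matrix.specialUnitaryGroup (Fin 2) ℂ) (l : ι) => -(1 / (4 * κ)) • (fun (W : ι → Matrix.specialUnitaryGroup (Fin 2) ℂ) (l : ι) => WithLp.toLp 2 (fun i : Fin 3 => fderiv ℝ (fun a : ι → EuclideanSpace ℝ (Fin 3) => S (su2ExpDrift ε a * W)) 0 (Pi.single l (EuclideanSpace.single i (1 : ℝ))))) W l) z.1) l‖ := Finset.sum_nonneg fun l _ => norm_nonneg _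
      gcongr
    -- telescope
    calc |(S (su2ExpDrift ε (z.2 + (fun (W : ι → Matrix.specialUnitaryGroup (Fin 2) ℂ) (l : ι) => -(1 / (4 * κ)) • (fun (W : ι → Matrix.specialUnitaryGroup (Fin 2) ℂ) (l : ι) => WithLp.toLp 2 (fun i : Fin 3 => fderiv ℝ (fun a : ι → EuclideanSpace ℝ (Fin 3) => S (su2ExpDrift ε a * W)) 0 (Pi.single l (EuclideanSpace.single i (1 : ℝ))))) W l) z.1) * z.1) +
            su2Kinetic κ (z.2 + (fun (W : ι → Matrix.specialUnitaryGroup (Fin 2) ℂ) (l : ι) => -(1 / (4 * κ)) • (fun (W : ι → Matrix.specialUnitaryGroup (Fin 2) ℂ) (l : ι) => WithLp.toLp 2 (fun i : Fin 3 => fderiv ℝ (fun a : ι → EuclideanSpace ℝ (Fin 3) => S (su2ExpDrift ε a * W)) 0 (Pi.single l (EuclideanSpace.single i (1 : ℝ))))) W l) z.1 + (fun (W : ι → Matrix.specialUnitaryGroup (Fin 2) ℂ) (l : ι) => -(1 / (4 * κ)) • (fun (W : ι → Matrix.specialUnitaryGroup (Fin 2) ℂ) (l : ι) => WithLp.toLp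 2 (fun i : Fin 3 => fderiv ℝ (fun a : ι → EuclideanSpace ℝ (Fin 3) => S (su2ExpDrift ε a * W)) 0 (Pi.single l (EuclideanSpace.single i (1 : ℝ))))) W l) (su2ExpDrift ε (z.2 + (fun (W : ι → Matrix.specialUnitaryGroup (Fin 2) ℂ) (l : ι) => -(1 / (4 * κ)) • (fun (W : ι → Matrix.specialUnitaryGroup (Fin 2) ℂ) (l : ι) => WithLp.toLp 2 (fun i : Fin 3 => fderiv ℝ (fun a : ι → EuclideanSpace ℝ (Fin 3) => S (su2ExpDrift ε a * W)) 0 (Pi.single l (EuclideanSpace.single i (1 : ℝ))))) W l) z.1) * z.1))) -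
          (S q + su2Kinetic κ p)|
        ≤ |(S (su2ExpDrift ε (z.2 + (fun (W : ι → Matrix.specialUnitaryGroup (Fin 2) ℂ) (l : ι) => -(1 / (4 * κ)) • (fun (W : ι → Matrix.specialUnitaryGroup (Fin 2) ℂ) (l : ι) => WithLp.toLp 2 (fun i : Fin 3 => fderiv ℝ (fun a : ι → EuclideanSpace ℝ (Fin 3) => S (su2ExpDrift ε a * W)) 0 (Pi.single l (EuclideanSpace.single i (1 : ℝ))))) W l) z.1) * z.1) +
              su2Kinetic κ (z.2 + (fun (W : ι → Matrix.specialUnitaryGroup (Fin 2) ℂ) (l : ι) => -(1 / (4 * κ)) • (fun (W : ι → Matrix.specialUnitaryGroup (Fin 2) ℂ) (l : ι) => WithLp.toLp 2 (fun i : Fin 3 => fderiv ℝ (fun a : ι → EuclideanSpace ℝ (Fin 3) => S (su2ExpDrift ε a * W)) 0 (Pi.single l (EuclideanSpace.single i (1 : ℝ))))) W l) z.1 + (fun (W : ι → Matrix.specialUnitaryGroup (Fin 2) ℂ) (l : ι) => -(1 / (4 * κ)) • (fun (W : ι → Matrix.specialUnitaryGroup (Fin 2) ℂ) (l : ι) =>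 WithLp.toLp 2 (fun i : Fin 3 => fderiv ℝ (fun a : ι → EuclideanSpace ℝ (Fin 3) => S (su2ExpDrift ε a * W)) 0 (Pi.single l (EuclideanSpace.single i (1 : ℝ))))) W l) (su2ExpDrift ε (z.2 + (fun (W : ι → Matrix.specialUnitaryGroup (Fin 2) ℂ) (l : ι) => -(1 / (4 * κ)) • (fun (W : ι → Matrix.specialUnitaryGroup (Fin 2) ℂ) (l : ι) => WithLp.toLp 2 (fun i : Fin 3 => fderiv ℝ (fun a : ι → EuclideanSpace ℝ (Fin 3) => S (su2ExpDrift ε a * W)) 0 (Pi.single l (EuclideanSpace.single i (1 : ℝ))))) W l) z.1) * z.1))) -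
            (S z.1 + su2Kinetic κ z.2)| + |(S z.1 + su2Kinetic κ z.2) - (S q + su2Kinetic κ p)| := abs_sub_le _ _ _
      _ ≤ B + k * B := add_le_add hstep' ih
      _ = ((k + 1 : ℕ) : ℝ) * B := by push_cast; ring

/-- **THE ENERGY ERROR OF THE ENGINE'S `n`-STEP `SU(2)` PROPOSAL** `sunLeapfrogProposalN … ε g n = flip ∘ (kick–drift–kick)ⁿ`
in Pauli coordinates with the consistent half kick — the quantity in the Metropolis test of `su2LeapfrogHMCN ε κ hg S n`:
`|H(Ψ_n(q,p)) − H(q,p)| ≤ n · K·(‖p‖ + (2n+1)·D_max/(4κ))·|ε|·(8(Σ_l‖p_l‖ + (2n+1)·|ι|·D_max/(4κ)) + |ι|·D_max/κ)`.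
Hence the acceptance probability of the proposal is at least `exp(−that)` pointwise; with `K, D_max = O(ε)`
the bound is `O(nε²) = O(τε)` at fixed trajectory length `τ = nε`. -/
theorem abs_su2LeapfrogProposalN_energy_error_le (S : (ι → Matrix.specialUnitaryGroup (Fin 2) ℂ) → ℝ) (ε κ : ℝ)
    (hκ : 0 < κ)
    (hd : ∀ W : ι → Matrix.specialUnitaryGroup (Fin 2) ℂ,
      DifferentiableAt ℝ (fun a : ι → EuclideanSpace ℝ (Fin 3) => S (su2ExpDrift ε a * W)) 0)
    {Dmax K : ℝ} (hD0 : 0 ≤ Dmax) (hK0 : 0 ≤ K)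
    (hDb : ∀ (W : ι → Matrix.specialUnitaryGroup (Fin 2) ℂ) (l : ι), ‖(fun (W : ι → Matrix.specialUnitaryGroup (Fin 2) ℂ) (l : ι) => WithLp.toLp 2 (fun i : Fin 3 => fderiv ℝ (fun a : ι → EuclideanSpace ℝ (Fin 3) => S (su2ExpDrift ε a * W)) 0 (Pi.single l (EuclideanSpace.single i (1 : ℝ))))) W l‖ ≤ Dmax)
    (hDK : ∀ W W' : ι → Matrix.specialUnitaryGroup (Fin 2) ℂ, ‖(fun (W : ι → Matrix.specialUnitaryGroup (Fin 2) ℂ) (l : ι) => WithLp.toLp 2 (fun i : Fin 3 => fderiv ℝ (fun a : ι → EuclideanSpace ℝ (Fin 3) => S (su2ExpDrift ε a * W)) 0 (Pi.single l (EuclideanSpace.single i (1 : ℝ))))) W - (fun (W : ι → Matrix.specialUnitaryGroup (Fin 2) ℂ) (l : ι) => WithLp.toLp 2 (fun i : Fin 3 => fderiv ℝ (fun a : ι → EuclideanSpace ℝ (Fin 3) => S (su2ExpDrift ε a * W)) 0 (Pi.single l (EuclideanSpace.single i (1 : ℝ))))) W'‖ ≤ K * ‖coeConfig W - coeConfig 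W'‖)
    (q : ι → Matrix.specialUnitaryGroup (Fin 2) ℂ) (p : ι → EuclideanSpace ℝ (Fin 3)) (n : ℕ) :
    |(S (sunLeapfrogProposalN pauliCoordι pauliCoordι_skew ε (fun (W : ι → Matrix.specialUnitaryGroup (Fin 2) ℂ) (l : ι) => -(1 / (4 * κ)) • (fun (W : ι → Matrix.specialUnitaryGroup (Fin 2) ℂ) (l : ι) => WithLp.toLp 2 (fun i : Fin 3 => fderiv ℝ (fun a : ι → EuclideanSpace ℝ (Fin 3) => S (su2ExpDrift ε a * W)) 0 (Pi.single l (EuclideanSpace.single i (1 : ℝ))))) W l) n (q, p)).1 +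
        su2Kinetic κ (sunLeapfrogProposalN pauliCoordι pauliCoordι_skew ε (fun (W : ι → Matrix.specialUnitaryGroup (Fin 2) ℂ) (l : ι) => -(1 / (4 * κ)) • (fun (W : ι → Matrix.specialUnitaryGroup (Fin 2) ℂ) (l : ι) => WithLp.toLp 2 (fun i : Fin 3 => fderiv ℝ (fun a : ι → EuclideanSpace ℝ (Fin 3) => S (su2ExpDrift ε a * W)) 0 (Pi.single l (EuclideanSpace.single i (1 : ℝ))))) W l) n (q, p)).2) - (S q + su2Kinetic κ p)| ≤
      n * (K * (‖p‖ + (2 * n + 1) * (Dmax / (4 * κ))) * |ε| *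
        (8 * (∑ l, ‖p l‖ + (2 * n + 1) * (Fintype.card ι * (Dmax / (4 * κ)))) + Fintype.card ι * Dmax / κ)) := by
  have h := abs_su2LeapfrogN_energy_error_le S ε κ hκ hd hD0 hK0 hDb hDK q p n n le_rfl
  rw [sunLeapfrogProposalN, sunExpDrift_pauliCoordι, Equiv.Perm.coe_mul, Function.comp_apply, flip_apply,
    Equiv.Perm.coe_pow]
  simp only [su2Kinetic_neg]
  exact h

end Trajectory

end Summit.Ventures.LatticeQCDFlow.Exactness
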